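import Summits.BirchSwinnertonDyer.BirchSwinnertonDyer.Theorems.CyclotomicUntwistUntwistFrame
import Summits.BirchSwinnertonDyer.BirchSwinnertonDyer.Theorems.CyclotomicUntwistNineCharacter
import HarnessLib

/-!
# Print layer (T) of crux child C1, file 3b-ii: the twisted `ℓ`-adic frame at `3` on a principal-series row
# — the untwisting character, the fixed vector of the inertia generator, the Frobenius

Cell `pub/bsd-wall` (D-0145 line `route-BirchSwinnertonDyer-CyclotomicUntwist`), seat `bsd-line-cycu-p1`
(K1/K2 LEAD lineage, gen 8). THEOREMS ONLY (no definition, no named fact, no `sorry`); helper toward the crux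
child C1 = stmt-BirchSwinnertonDyer-27548 through the print layer (T) (files 1, 2, 3a: p646654, p647742,
p648344). BSD is not proved by this file; no crux and no child of the route is proved by it.

WHAT. `W/ℚ` on a principal-series row at `3`, `VQ : Γ_ℚ → GL₂(ℚ_ℓ)` a frame of `V_ℓ(W)` (`eV`, `heV` as in
`exists_framedGaloisRep_rationalTate`), `𝔓 ∣ 3`.
(§1 frame bookkeeping and §2 plane linear algebra: file 3b-i `CyclotomicUntwistUntwistFrame`.)
* §3 `exists_untwistDatum` — granted WILDNESS in Galois form (`∃ i ∈ I_𝔓`, `χ₉(i) = 4`, `ρ(i) ≠ 1`): there are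
  a Dirichlet character `ε` mod `9` with `ε(4) ≠ 1` (so `ε` and `ε⁻¹` are primitive, file 3a), the continuous
  character `ψ = ι⁻¹ ∘ ε ∘ χ₉` of `Γ_ℚ`, `τ ∈ I_𝔓` and an arithmetic Frobenius `σ` at `𝔓` such that on the twisted
  frame `ρ = (VQ ⊗ ℚ̄_ℓ) ⊗ ψ`: the inertia acts through powers of `ρ(τ)`, `ρ(τ)` fixes a non-zero vector, and
  `charpoly ρ(σ) = X² − a_w(W)X + 3` — the three Galois-side inputs of
  `CoinvariantEigenvalue.isRoot_charpoly_of_charpoly_reverse_toInertiaCoinvariants_eq` (file 1) for the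
  coinvariant Euler factor delivered by Carayol (engine `map_reverse_charpoly_toInertiaCoinvariants_twist_eq`).

References: [cite: CarayolASENS1986, Thm. (A)] · [cite: SerreTate1968, §1–§2] · [cite: Washington1997, Ch. 3].
-/

set_option autoImplicit false
-- single-conjunct summit: `Summit.BirchSwinnertonDyer.BirchSwinnertonDyer.…` repeats the name by design
set_option linter.dupNamespace false

noncomputable section

open scoped NumberField
open Polynomial Module NumberField IsDedekindDomain Field
  Literature.NumberTheory.GaloisRepresentations Literature.NumberTheory.EllipticCurves
  Summit.BirchSwinnertonDyer.Rank1Residual.Additive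
  Summit.BirchSwinnertonDyer.BirchSwinnertonDyer.Theorems.InertiaOverCyclotomicNine

open Summit.BirchSwinnertonDyer.BirchSwinnertonDyer.Theorems.UntwistFrame

namespace Summit.BirchSwinnertonDyer.BirchSwinnertonDyer.Theorems.UntwistDatum

/-! ### §3 The twisted frame at `3` on a principal-series row -/

section Datum

open Summit.BirchSwinnertonDyer.BirchSwinnertonDyer.Theorems.NineCharacter

variable (W : WeierstrassCurve ℚ) [W.IsElliptic] [W.IsGloballyMinimal]

set_option maxHeartbeats 800000 in
/-- **The untwist datum at `3`.** On a principal-series row, with a frame `VQ` of `V_ℓ(W)` (`ℓ ≠ 3`),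
`ι : ℚ̄_ℓ ≃ ℂ`, a prime `𝔓 ∣ 3` and WILDNESS in Galois form (an element of `I_𝔓` with mod-`9` cyclotomic character
`4` acting non-trivially): there are a Dirichlet character `ε` mod `9` with `ε(4) ≠ 1` (so `ε`, `ε⁻¹` are
primitive), the continuous character `ψ = ι⁻¹ ∘ ε ∘ χ₉` of `Γ_ℚ`, `τ ∈ I_𝔓` and an arithmetic Frobenius `σ` at `𝔓`
with `χ₉(σ) = 1` such that on `ρ = (VQ ⊗ ℚ̄_ℓ) ⊗ ψ`: every element of `I_𝔓` acts as a power of `ρ(τ)`, `ρ(τ)`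
fixes a non-zero vector, and `charpoly ρ(σ) = X² − a_w(W)X + 3`. Construction: `χ₉(τ) = 2`; `ζ₀` an eigenvalue
of `VQ(τ)` over `ℚ̄_ℓ` with `ζ₀² ≠ 1` (`VQ(τ)⁶ = 1` since `τ⁶` fixes `ζ₉`; `VQ(τ)² ≠ 1` by wildness; §2);
`ε(2) = ι(ζ₀)⁻¹` (file 3a); then `ψ(τ)ρ̄(τ)` fixes the `ζ₀`-eigenvector.
[cite: SerreTate1968, §1–§2] [cite: CarayolASENS1986, Thm. (A)] [cite: Washington1997, Ch. 3] -/
theorem exists_untwistDatum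
    (hO6 : ClassO6 W 3) (hev : Even (padicValInt 3 W.minimalDiscriminantInt))
    (hsq : W.minimalDiscriminantInt / 3 ^ padicValInt 3 W.minimalDiscriminantInt % 3 = 1)
    (ℓ : ℕ) [Fact ℓ.Prime] (hℓ : ℓ ≠ 3) [Module.Finite ℚ_[ℓ] (W.rationalTateModule ℓ)]
    (ι : PadicAlgCl ℓ ≃+* ℂ) (VQ : FramedGaloisRep ℚ ℚ_[ℓ] 2)
    (eV : (Fin 2 → ℚ_[ℓ]) ≃ₗ[ℚ_[ℓ]] W.rationalTateModule ℓ)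
    (heV : ∀ (σ : absoluteGaloisGroup ℚ) (x : Fin 2 → ℚ_[ℓ]),
      eV (FramedRep.toRepresentation VQ σ x) = W.rationalGaloisRepTate ℓ σ (eV x))
    {v : HeightOneSpectrum (𝓞 ℚ)} (hv : (3 : 𝓞 ℚ) ∈ v.asIdeal)
    {𝔓 : Ideal (absIntegers (𝓞 ℚ) ℚ)} (h𝔓 : 𝔓 ∈ v.primesAbove)
    (hwild : ∃ i ∈ 𝔓.inertia (absoluteGaloisGroup ℚ),
      (modNCyclotomicCharacter ℚ 9 i : ZMod 9) = 4 ∧ W.rationalGaloisRepTate ℓ i ≠ 1) :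
    ∃ (ε : DirichletCharacter ℂ 9) (ψ : absoluteGaloisGroup ℚ →ₜ* (PadicAlgCl ℓ)ˣ)
      (τ σ : absoluteGaloisGroup ℚ),
      ε (4 : ZMod 9) ≠ 1 ∧
      (∀ g, (ψ g : PadicAlgCl ℓ) = ι.symm (ε (modNCyclotomicCharacter ℚ 9 g : ZMod 9))) ∧
      τ ∈ 𝔓.inertia (absoluteGaloisGroup ℚ) ∧ IsArithFrobAt (𝓞 ℚ) σ 𝔓 ∧
      modNCyclotomicCharacter ℚ 9 σ = 1 ∧
      (∀ s ∈ 𝔓.inertia (absoluteGaloisGroup ℚ), ∃ j : ℕ,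
        (FramedGaloisRep.toGaloisRep (((VQ.baseChange (algebraMap ℚ_[ℓ] (PadicAlgCl ℓ))
          (continuous_algebraMap_padicAlgCl ℓ)).twist ψ))) s =
        (FramedGaloisRep.toGaloisRep (((VQ.baseChange (algebraMap ℚ_[ℓ] (PadicAlgCl ℓ))
          (continuous_algebraMap_padicAlgCl ℓ)).twist ψ))) τ ^ j) ∧
      (∃ w : Fin 2 → PadicAlgCl ℓ, w ≠ 0 ∧
        (FramedGaloisRep.toGaloisRep (((VQ.baseChange (algebraMap ℚ_[ℓ] (PadicAlgCl ℓ))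
          (continuous_algebraMap_padicAlgCl ℓ)).twist ψ))) τ w = w) ∧
      ((FramedGaloisRep.toGaloisRep (((VQ.baseChange (algebraMap ℚ_[ℓ] (PadicAlgCl ℓ))
          (continuous_algebraMap_padicAlgCl ℓ)).twist ψ))) σ).charpoly =
        X ^ 2 - C (((W.psUntwistedTrace : ℤ) : PadicAlgCl ℓ)) * X + C (3 : PadicAlgCl ℓ) := by
  classical
  haveI : NeZero ((9 : ℕ) : ℚ) := ⟨by norm_num⟩
  set f := algebraMap ℚ_[ℓ] (PadicAlgCl ℓ) with hf
  have hfinj : Function.Injective f := (algebraMap ℚ_[ℓ] (PadicAlgCl ℓ)).injective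
  set ρ₀ := W.rationalGaloisRepTate ℓ with hρ₀
  -- notation for matrices of the frame
  set M : absoluteGaloisGroup ℚ → Matrix (Fin 2) (Fin 2) ℚ_[ℓ] :=
    fun g => ((VQ g : GL (Fin 2) ℚ_[ℓ]) : Matrix (Fin 2) (Fin 2) ℚ_[ℓ]) with hM
  -- `τ ∈ I_𝔓` with `χ₉(τ) = 2`
  obtain ⟨τ, hτI, hχτu⟩ :=
    exists_mem_inertia_modNCyclotomicCharacter_nine_eq hv h𝔓 (ZMod.unitOfCoprime 2 (by decide))
  have hχτ : (modNCyclotomicCharacter ℚ 9 τ : ZMod 9) = 2 := by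
    rw [hχτu, ZMod.coe_unitOfCoprime, Nat.cast_ofNat]
  -- the Frobenius `σ` (file 2)
  obtain ⟨σ, hσ, hχσ, hcharσ⟩ :=
    exists_isArithFrobAt_charpoly_rationalGaloisRepTate W hO6 hev hsq ℓ hℓ hv h𝔓
  -- elements of `I_𝔓` fixing `ζ₉`: trivial matrices
  have htrivM : ∀ g ∈ 𝔓.inertia (absoluteGaloisGroup ℚ), modNCyclotomicCharacter ℚ 9 g = 1 → M g = 1 :=
    fun g hg hχ => coe_eq_one_of_forall_apply_eq W VQ eV heV fun x =>
      rationalGaloisRepTate_apply_eq_self_of_mem_inertia_of_modNCyclotomicCharacter_eq_one W hO6 hev hsq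
        ℓ hℓ hv h𝔓 hg hχ x
  -- decomposition `s = τ^j · h` with `h` fixing `ζ₉`
  have hdecomp : ∀ s ∈ 𝔓.inertia (absoluteGaloisGroup ℚ), ∃ j : Fin 6,
      ∃ h ∈ 𝔓.inertia (absoluteGaloisGroup ℚ), modNCyclotomicCharacter ℚ 9 h = 1 ∧
        (modNCyclotomicCharacter ℚ 9 s : ZMod 9) = 2 ^ (j : ℕ) ∧ s = τ ^ (j : ℕ) * h := by
    intro s hs
    obtain ⟨j, hj⟩ := exists_coe_eq_two_pow (modNCyclotomicCharacter ℚ 9 s)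
    refine ⟨j, (τ ^ (j : ℕ))⁻¹ * s,
      Subgroup.mul_mem _ (Subgroup.inv_mem _ (Subgroup.pow_mem _ hτI _)) hs, ?_, hj,
      by rw [mul_inv_cancel_left]⟩
    apply Units.ext
    have h1 : ((modNCyclotomicCharacter ℚ 9 (τ ^ (j : ℕ)) : (ZMod 9)ˣ) : ZMod 9) = 2 ^ (j : ℕ) := by
      rw [map_pow, Units.val_pow_eq_pow_val, hχτ]
    rw [map_mul, map_inv, Units.val_mul, Units.val_one, hj, ← h1, Units.inv_mul]
  -- `M(τ)⁶ = 1`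
  have hMτ6 : M τ ^ 6 = 1 := by
    have h6 : M (τ ^ 6) = 1 := by
      refine htrivM _ (Subgroup.pow_mem _ hτI 6) ?_
      apply Units.ext
      rw [map_pow, Units.val_pow_eq_pow_val, hχτ, Units.val_one]; decide
    have : M (τ ^ 6) = M τ ^ 6 := by simp only [hM, map_pow, Units.val_pow_eq_pow_val]
    rw [← this, h6]
  -- `M(τ)² ≠ 1` (wildness)
  have hMτ2 : M τ ^ 2 ≠ 1 := by
    obtain ⟨iw, hiwI, hχiw, hiw⟩ := hwild
    obtain ⟨j, h, hhI, hχh, hχs, hiw_eq⟩ := hdecomp iw hiwI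
    have hj2 : (j : ℕ) = 2 := by
      have key : ∀ j : Fin 6, (2 : ZMod 9) ^ (j : ℕ) = 4 → (j : ℕ) = 2 := by decide
      exact key j (by rw [← hχs, hχiw])
    intro hsq2
    apply hiw
    -- `ρ₀(iw) = ρ₀(τ)² ρ₀(h) = 1`
    have hρh : ρ₀ h = 1 := LinearMap.ext fun x =>
      rationalGaloisRepTate_apply_eq_self_of_mem_inertia_of_modNCyclotomicCharacter_eq_one W hO6 hev hsq
        ℓ hℓ hv h𝔓 hhI hχh x
    have hρτ2 : ρ₀ (τ ^ 2) = 1 := by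
      have hM2 : M (τ ^ 2) = 1 := by
        have : M (τ ^ 2) = M τ ^ 2 := by simp only [hM, map_pow, Units.val_pow_eq_pow_val]
        rw [this, hsq2]
      have hconj := toLin'_coe_eq_conj W VQ eV heV (τ ^ 2)
      rw [show ((VQ (τ ^ 2) : GL (Fin 2) ℚ_[ℓ]) : Matrix (Fin 2) (Fin 2) ℚ_[ℓ]) = M (τ ^ 2) from rfl, hM2,
        Matrix.toLin'_one, ← LinearEquiv.conj_id eV.symm] at hconj
      exact (eV.symm.conj.injective hconj).symm
    rw [hiw_eq, hj2, map_mul, hρτ2, hρh, one_mul]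
  -- the base-changed matrix of `τ` and its endomorphism `T̄`
  set T : Module.End (PadicAlgCl ℓ) (Fin 2 → PadicAlgCl ℓ) := Matrix.toLinAlgEquiv' ((M τ).map f) with hT
  have hmapM : ∀ k : ℕ, ((M τ).map f) ^ k = (M τ ^ k).map f := fun k => by
    rw [← RingHom.mapMatrix_apply, ← map_pow, RingHom.mapMatrix_apply]
  have hT6 : T ^ 6 = 1 := by
    rw [hT, ← map_pow, hmapM, hMτ6, Matrix.map_one f (map_zero f) (map_one f), map_one]
  have hT2 : T ^ 2 ≠ 1 := by
    intro h2
    apply hMτ2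
    rw [hT, ← map_pow, hmapM, ← (Matrix.toLinAlgEquiv' (R := PadicAlgCl ℓ) (n := Fin 2)).map_one] at h2
    have h3 := Matrix.toLinAlgEquiv'.injective h2
    rw [← Matrix.map_one f (map_zero f) (map_one f)] at h3
    exact Matrix.map_injective hfinj h3
  -- an eigenvalue `ζ₀` with `ζ₀² ≠ 1`, and an eigenvector
  obtain ⟨ζ₀, hζ₀, hζ₀sq⟩ := exists_hasEigenvalue_sq_ne_one (by simp) T hT6 hT2
  obtain ⟨v₀, hv₀⟩ := hζ₀.exists_hasEigenvector
  have hTv₀ : T v₀ = ζ₀ • v₀ := hv₀.apply_eq_smul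
  have hζ₀6 : ζ₀ ^ 6 = 1 := by
    have hpow : ∀ n : ℕ, (T ^ n) v₀ = ζ₀ ^ n • v₀ := by
      intro n
      induction n with
      | zero => simp
      | succ n ih => rw [pow_succ', pow_succ', Module.End.mul_apply, ih, map_smul, hTv₀, smul_smul, mul_comm]
    have h := hpow 6
    rw [hT6, Module.End.one_apply] at h
    have h' : (ζ₀ ^ 6 - 1) • v₀ = 0 := by rw [sub_smul, ← h, one_smul, sub_self]
    rcases smul_eq_zero.mp h' with h' | h'
    · exact sub_eq_zero.mp h'
    · exact absurd h' hv₀.2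
  have hζ₀0 : ζ₀ ≠ 0 := by rintro rfl; norm_num at hζ₀6
  -- the untwisting character `ε` with `ε(2) = ι(ζ₀)⁻¹`
  set c : ℂ := (ι ζ₀)⁻¹ with hc
  have hc6 : c ^ 6 = 1 := by rw [hc, inv_pow, ← map_pow, hζ₀6, map_one, inv_one]
  obtain ⟨ε, hε2, hε4⟩ := exists_dirichletCharacter_nine_apply_two_eq c hc6
  have hε4ne : ε (4 : ZMod 9) ≠ 1 := by
    rw [hε4, hc, inv_pow, ← map_pow]
    intro h
    apply hζ₀sq
    have h' : ι (ζ₀ ^ 2) = ι 1 := by rw [map_one]; exact inv_eq_one.mp h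
    exact ι.injective h'
  -- the Galois character `ψ = ι⁻¹ ∘ ε ∘ χ₉`
  obtain ⟨ψ, hψ⟩ := exists_continuousMonoidHom_apply_eq_dirichlet 9 (ι.symm : ℂ →+* PadicAlgCl ℓ) ε
  have hψ1 : ∀ g, modNCyclotomicCharacter ℚ 9 g = 1 → ψ g = 1 := by
    intro g hg
    apply Units.ext
    rw [hψ, hg, Units.val_one, MulChar.map_one, RingEquiv.coe_toRingHom, map_one, Units.val_one]
  have hψτ : (ψ τ : PadicAlgCl ℓ) = ζ₀⁻¹ := by
    rw [hψ, hχτ, hε2, hc, RingEquiv.coe_toRingHom, map_inv₀, RingEquiv.symm_apply_apply]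
  -- the twisted representation
  set ρ := FramedGaloisRep.toGaloisRep (((VQ.baseChange (algebraMap ℚ_[ℓ] (PadicAlgCl ℓ))
    (continuous_algebraMap_padicAlgCl ℓ)).twist ψ)) with hρ
  have hρapply : ∀ (g : absoluteGaloisGroup ℚ) (x : Fin 2 → PadicAlgCl ℓ),
      ρ g x = (ψ g : PadicAlgCl ℓ) • (((M g).map f).mulVec x) := by
    intro g x
    rw [hρ, FramedRep.toContinuousRep_apply_apply, FramedRep.coe_twist_apply, FramedRep.coe_baseChange_apply,
      Matrix.smul_mulVec]
  have hρmul : ∀ a b : absoluteGaloisGroup ℚ, ρ (a * b) = ρ a * ρ b := fun a b => map_mul ρ.toRepresentation a b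
  have hρpow : ∀ (a : absoluteGaloisGroup ℚ) (k : ℕ), ρ (a ^ k) = ρ a ^ k :=
    fun a k => map_pow ρ.toRepresentation a k
  refine ⟨ε, ψ, τ, σ, hε4ne, hψ, hτI, hσ, hχσ, ?_, ?_, ?_⟩
  · -- cyclic generation of the inertia action
    intro s hs
    obtain ⟨j, h, hhI, hχh, -, hs_eq⟩ := hdecomp s hs
    refine ⟨j, ?_⟩
    have hρh : ρ h = 1 := by
      refine LinearMap.ext fun x => ?_
      rw [hρapply, htrivM h hhI hχh, hψ1 h hχh, Units.val_one, one_smul,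
        Matrix.map_one f (map_zero f) (map_one f), Matrix.one_mulVec, Module.End.one_apply]
    rw [hs_eq, hρmul, hρpow, hρh, mul_one]
  · -- the fixed vector
    refine ⟨v₀, hv₀.2, ?_⟩
    rw [hρapply, hψτ, ← Matrix.toLinAlgEquiv'_apply, ← hT, hTv₀, smul_smul, inv_mul_cancel₀ hζ₀0, one_smul]
  · -- the characteristic polynomial of `σ`
    have hρσ : ρ σ = Matrix.toLin' ((M σ).map f) := by
      refine LinearMap.ext fun x => ?_
      rw [hρapply, hψ1 σ hχσ, Units.val_one, one_smul, Matrix.toLin'_apply]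
    rw [hρσ, Matrix.charpoly_toLin', Matrix.charpoly_map, charpoly_coe_eq W VQ eV heV σ, hcharσ]
    simp only [Polynomial.map_add, Polynomial.map_sub, Polynomial.map_mul, Polynomial.map_pow, map_X,
      map_intCast, map_ofNat, hf, Polynomial.map_intCast, Polynomial.map_ofNat]

end Datum

end Summit.BirchSwinnertonDyer.BirchSwinnertonDyer.Theorems.UntwistDatum

end
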